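import Mathlib
import Summits.AtomisticToContinuum.FouriersLaw.Theses.EmbeddedDrudeMourre
import Summits.AtomisticToContinuum.FouriersLaw.Theorems.EmbeddedDrudeMourreDrudeDissolutionStubFreeOddExcursionKernelAbelWindow
import HarnessLib

/-!
# Stub B1a `stub_excursionKernelPushforward` of line `kinetic-polymer-gas-on-the-time-axis`
(crux `EmbeddedDrudeMourre.DrudeDissolution`, item stmt-AtomisticToContinuum-12593; `--supports` file, closes
nothing; lead c13, 2026-08-17)

WHAT. The registered stub B1a of the crux's skeleton
(`Cruxes/DrudeDissolution/Lines/kinetic_polymer_gas_on_the_time_axis.lean`, v3): for `ω₂ > 0`, couplings `a, b`,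
a continuous profile `f` and every `t`, the free odd excursion kernel written as a box integral over
`Set.pi univ (Ioc (-π) π) ⊆ (Fin 3 → ℝ)`,
`F_f(t) = ∫ Φ²·[f]²·(ω₁ω₂ω₃ω₄)⁻²·cos(tΩ) dk`,
equals the cosine transform `∫ cos(t x) dm_f(x)` of the bracket-weighted two-phonon density of states
`m_f = Ω_*(W dk)` of the sibling crux stmt-12594 (cell read at `p = (k₁,(k₃,k₂))`).

HOW. This is the LANDED identity `freeOddExcursionKernel_eq_cosTransform` (lead c11, p140460), whose
right-hand side carries `cos(x t)` instead of `cos(t x)`; commute the product.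
-/

noncomputable section

open MeasureTheory Filter Set Function Topology Real
open scoped ENNReal NNReal Topology
open Literature.MathematicalPhysics.KineticTheory
open Literature.MathematicalPhysics.KineticTheory.PhononBoltzmann

namespace Summit.AtomisticToContinuum.FouriersLaw.Theorems.DrudeDissolution.KineticPolymerGasOnTheTimeAxis

/-- **Stub B1a `stub_excursionKernelPushforward` (registered signature, verbatim).** For `ω₂ > 0`,
couplings `a, b`, a continuous profile `f` and every `t`, the free odd excursion kernel of the `(2,2)` sector
(box integral over the cell `(−π,π]³ ⊆ (Fin 3 → ℝ)`) is the cosine transform `∫ cos(t x) dm_f(x)` of the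
pushforward `m_f = Ω_*(W dk)`, `W = Φ²/(∏ω)²·[f]²`, of the iterated product cell read at `p = (k₁,(k₃,k₂))`.
Corollary of `freeOddExcursionKernel_eq_cosTransform`. [folklore] -/
theorem stub_excursionKernelPushforward :
    ∀ ω₂ a b : ℝ, 0 < ω₂ → ∀ f : ℝ → ℝ, Continuous f → ∀ t : ℝ,
      (∫ k in Set.pi Set.univ (fun _ : Fin 3 => Set.Ioc (-π) π),
          vertex a b (k 0) (k 1) (k 2) ^ 2 *
            (f (k 0) + f (k 1) - f (k 2) - f (k 0 + k 1 - k 2)) ^ 2 /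
            (dispersion ω₂ (k 0) * dispersion ω₂ (k 1) * dispersion ω₂ (k 2) *
              dispersion ω₂ (k 0 + k 1 - k 2)) ^ 2 *
            Real.cos (t * resonanceFn ω₂ (k 0) (k 1) (k 2))) =
        ∫ x, Real.cos (t * x) ∂(MeasureTheory.Measure.map (fun p : ℝ × ℝ × ℝ => resonanceFn ω₂ p.1 p.2.2 p.2.1)
            (((volume.restrict (Set.Ioc (-Real.pi) Real.pi)).prod
                ((volume.restrict (Set.Ioc (-Real.pi) Real.pi)).prod
                  (volume.restrict (Set.Ioc (-Real.pi) Real.pi)))).withDensity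
              (fun p : ℝ × ℝ × ℝ => ENNReal.ofReal
                (vertex a b p.1 p.2.2 p.2.1 ^ 2 /
                    (dispersion ω₂ p.1 * dispersion ω₂ p.2.2 * dispersion ω₂ p.2.1 *
                      dispersion ω₂ (p.1 + p.2.2 - p.2.1)) ^ 2 *
                  (f p.1 + f p.2.2 - f p.2.1 - f (p.1 + p.2.2 - p.2.1)) ^ 2)))) := by
  intro ω₂ a b hω f hf t
  rw [freeOddExcursionKernel_eq_cosTransform ω₂ a b hω f hf t]
  refine integral_congr_ae (ae_of_all _ (fun x => ?_))
  show Real.cos (x * t) = Real.cos (t * x)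
  rw [mul_comm x t]

end Summit.AtomisticToContinuum.FouriersLaw.Theorems.DrudeDissolution.KineticPolymerGasOnTheTimeAxis

end
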